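import Mathlib
import HarnessLib

/-!
# THE TIP OF SKELETON ➎, CORNER INTEGRALS: the explicit real integrals of the corner (`|p| < ρ₀`) and of the tip letter `δt`
# (cell ym-idea-1; free-hands support of ⟨stmt-QuantumFields-24197⟩ `SwapVirialDeficit.SwapGluedStiffness`; layer 2 of the tip plug, g49 2026-09-01 00:57Z plan:
# keep w2 g61's structured floor `det M ≥ α_uα_v + c_r(α_u x₀² + α_v y₀²)` whole ⟹ the tip ceiling `∝ (1+δt²)²/(1 + κ|p|²(1+δt²))` is `dδt`-integrable for EVERY core
# cut and the corner disc contributes a `τ`-rate)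

Pure real analysis (Mathlib only):
* §1 `arsinh_le_log_one_add_two_mul`, `integral_inv_sqrt_one_add_mul_sq` (`∫_{−ρ}^{ρ} (√(1+c x²))⁻¹ = 2·arsinh(√c ρ)/√c`, FTC with ✓`Real.hasDerivAt_arsinh`);
* §2 `inv_one_add_mul_add_le` (`(1 + c(x²+y²))⁻¹ ≤ (√(1+cx²))⁻¹·(√(1+cy²))⁻¹`), ★ `setIntegral_square_inv_one_add_mul_le`
  (`∫_{[−ρ,ρ]²} (1 + c|p|²)⁻¹ dp ≤ (2·arsinh(√c ρ)/√c)²` — the corner disc sits in the square; the crucial `1/c` decay);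
* §3 `arsinh_sq_le_rpow` (`arsinh(z)² ≤ 64·(1+2z)^{1/4}`, from `log x ≤ x^ε/ε`), ★ `integral_Ioi_inv_one_add_sq_mul_rpow_le`
  (`∫_{Ioi d} (1+δ²)⁻¹·(1+δ²)^{1/8} dδ ≤ 2·(4/3)·d^{−3/4}` for `d ≥ 1`, ✓`integral_Ioi_rpow_of_lt`) — the `τ^{3/8}`-rate of the corner.

HONEST LABEL: real-analysis bookkeeping toward the corner piece of `stub_core_tip`; `stub_core_tip`, ⟨24197⟩ ∕ ⟨24194⟩ OPEN; item of record ⟨24085⟩ `SubOctaveBounded`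
aside ∕ untouched; the Yang–Mills mass gap is NOT proved; no summit is proved by a line.  THEOREMS ONLY (0 `def`, 0 `sorry`), standard axioms, no instances.
Seat ym-line-fcl-p3 g49 (cell ym-idea-1, free hands = ➎ assembler), `--supports stmt-QuantumFields-24197`.  References: [folklore].
-/

set_option autoImplicit false

noncomputable section

open MeasureTheory Set Real intervalIntegral

namespace Summit.QuantumFields.YangMills.Theorems.SwapVirialDeficit.SectorLaplace

/-! ## §1 The one-dimensional profile `(√(1 + c x²))⁻¹` -/

/-- `arsinh z ≤ log(1 + 2z)` for `z ≥ 0` (`√(1+z²) ≤ 1 + z`). [folklore] -/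
theorem arsinh_le_log_one_add_two_mul {z : ℝ} (hz : 0 ≤ z) : Real.arsinh z ≤ Real.log (1 + 2 * z) := by
  unfold Real.arsinh
  have hs : Real.sqrt (1 + z ^ 2) ≤ 1 + z := by
    rw [Real.sqrt_le_left (by linarith)]
    nlinarith
  have hpos : 0 < z + Real.sqrt (1 + z ^ 2) := by positivity
  exact Real.log_le_log hpos (by linarith)

/-- The antiderivative: `d/dx [arsinh(√c·x)/√c] = (√(1 + c x²))⁻¹` (`c > 0`). [folklore] -/
theorem hasDerivAt_arsinh_scaled {c : ℝ} (hc : 0 < c) (x : ℝ) :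
    HasDerivAt (fun x : ℝ => Real.arsinh (Real.sqrt c * x) / Real.sqrt c) ((Real.sqrt (1 + c * x ^ 2))⁻¹) x := by
  have hsc : 0 < Real.sqrt c := Real.sqrt_pos.2 hc
  have h1 : HasDerivAt (fun x : ℝ => Real.sqrt c * x) (Real.sqrt c) x := by
    simpa using (hasDerivAt_id x).const_mul (Real.sqrt c)
  have h2 : HasDerivAt (fun x : ℝ => Real.arsinh (Real.sqrt c * x)) ((Real.sqrt (1 + (Real.sqrt c * x) ^ 2))⁻¹ * Real.sqrt c) x :=
    (Real.hasDerivAt_arsinh (Real.sqrt c * x)).comp x h1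
  have h3 := h2.div_const (Real.sqrt c)
  have e : (Real.sqrt (1 + (Real.sqrt c * x) ^ 2))⁻¹ * Real.sqrt c / Real.sqrt c = (Real.sqrt (1 + c * x ^ 2))⁻¹ := by
    rw [mul_div_assoc, div_self hsc.ne', mul_one, mul_pow, Real.sq_sqrt hc.le]
  rw [e] at h3
  exact h3

/-- ★ `∫_{−ρ}^{ρ} (√(1 + c x²))⁻¹ dx = 2·arsinh(√c·ρ)/√c` (`c > 0`). [folklore] -/
theorem integral_inv_sqrt_one_add_mul_sq {c : ℝ} (hc : 0 < c) (ρ : ℝ) :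
    ∫ x in (-ρ)..ρ, (Real.sqrt (1 + c * x ^ 2))⁻¹ = 2 * Real.arsinh (Real.sqrt c * ρ) / Real.sqrt c := by
  have hcont : Continuous fun x : ℝ => (Real.sqrt (1 + c * x ^ 2))⁻¹ := by
    refine Continuous.inv₀ (by fun_prop) (fun x => ?_)
    exact (Real.sqrt_pos.2 (by positivity)).ne'
  rw [integral_eq_sub_of_hasDerivAt (fun x _ => hasDerivAt_arsinh_scaled hc x) (hcont.intervalIntegrable _ _)]
  rw [show Real.sqrt c * -ρ = -(Real.sqrt c * ρ) by ring, Real.arsinh_neg]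
  ring

/-- The profile is at most `1` and positive. [folklore] -/
theorem inv_sqrt_one_add_mul_sq_pos_le {c : ℝ} (hc : 0 ≤ c) (x : ℝ) :
    0 < (Real.sqrt (1 + c * x ^ 2))⁻¹ ∧ (Real.sqrt (1 + c * x ^ 2))⁻¹ ≤ 1 := by
  have h1 : 1 ≤ Real.sqrt (1 + c * x ^ 2) := Real.one_le_sqrt.2 (by nlinarith [sq_nonneg x])
  exact ⟨by positivity, inv_le_one_of_one_le₀ h1⟩

/-! ## §2 The square integral of `(1 + c|p|²)⁻¹` -/

/-- `(1 + c(x²+y²))⁻¹ ≤ (√(1+cx²))⁻¹·(√(1+cy²))⁻¹` (`c ≥ 0`; `(1+a)(1+b) ≤ (1+a+b)²`). [folklore] -/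
theorem inv_one_add_mul_add_le {c : ℝ} (hc : 0 ≤ c) (x y : ℝ) :
    (1 + c * (x ^ 2 + y ^ 2))⁻¹ ≤ (Real.sqrt (1 + c * x ^ 2))⁻¹ * (Real.sqrt (1 + c * y ^ 2))⁻¹ := by
  have ha : 0 ≤ c * x ^ 2 := by positivity
  have hb : 0 ≤ c * y ^ 2 := by positivity
  rw [← mul_inv, ← Real.sqrt_mul (by positivity)]
  have hprod : Real.sqrt ((1 + c * x ^ 2) * (1 + c * y ^ 2)) ≤ 1 + c * (x ^ 2 + y ^ 2) := by
    rw [Real.sqrt_le_left (by positivity)]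
    nlinarith [mul_nonneg ha hb]
  have hpos : 0 < Real.sqrt ((1 + c * x ^ 2) * (1 + c * y ^ 2)) := Real.sqrt_pos.2 (by positivity)
  exact (inv_le_inv₀ (by positivity) hpos).2 hprod

/-- ★ **THE SQUARE INTEGRAL**: `∫_{[−ρ,ρ]×[−ρ,ρ]} (1 + c(x²+y²))⁻¹ ≤ (2·arsinh(√c·ρ)/√c)²` (`c > 0`, `ρ ≥ 0`). [folklore] -/
theorem setIntegral_square_inv_one_add_mul_le {c : ℝ} (hc : 0 < c) {ρ : ℝ} (hρ : 0 ≤ ρ) :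
    ∫ p in Icc (-ρ) ρ ×ˢ Icc (-ρ) ρ, (1 + c * (p.1 ^ 2 + p.2 ^ 2))⁻¹ ≤ (2 * Real.arsinh (Real.sqrt c * ρ) / Real.sqrt c) ^ 2 := by
  have hcont : Continuous fun x : ℝ => (Real.sqrt (1 + c * x ^ 2))⁻¹ := by
    refine Continuous.inv₀ (by fun_prop) (fun x => ?_)
    exact (Real.sqrt_pos.2 (by positivity)).ne'
  have hI1 : IntegrableOn (fun x : ℝ => (Real.sqrt (1 + c * x ^ 2))⁻¹) (Icc (-ρ) ρ) := hcont.integrableOn_Icc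
  -- the product bound is integrable on the square
  have hprodInt : IntegrableOn (fun p : ℝ × ℝ => (Real.sqrt (1 + c * p.1 ^ 2))⁻¹ * (Real.sqrt (1 + c * p.2 ^ 2))⁻¹) (Icc (-ρ) ρ ×ˢ Icc (-ρ) ρ) := by
    rw [IntegrableOn, Measure.volume_eq_prod, ← Measure.prod_restrict]
    exact hI1.mul_prod hI1
  have hm : Measurable fun p : ℝ × ℝ => (1 + c * (p.1 ^ 2 + p.2 ^ 2))⁻¹ := by fun_prop
  -- compare pointwise, then compute the product integral
  have hle : ∫ p in Icc (-ρ) ρ ×ˢ Icc (-ρ) ρ, (1 + c * (p.1 ^ 2 + p.2 ^ 2))⁻¹ ≤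
      ∫ p in Icc (-ρ) ρ ×ˢ Icc (-ρ) ρ, (Real.sqrt (1 + c * p.1 ^ 2))⁻¹ * (Real.sqrt (1 + c * p.2 ^ 2))⁻¹ := by
    refine integral_mono_of_nonneg (Filter.Eventually.of_forall fun p => by positivity) hprodInt
      (Filter.Eventually.of_forall fun p => inv_one_add_mul_add_le hc.le p.1 p.2)
  refine hle.trans (le_of_eq ?_)
  rw [Measure.volume_eq_prod, setIntegral_prod_mul (fun x : ℝ => (Real.sqrt (1 + c * x ^ 2))⁻¹) (fun y : ℝ => (Real.sqrt (1 + c * y ^ 2))⁻¹) (Icc (-ρ) ρ) (Icc (-ρ) ρ)]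
  rw [integral_Icc_eq_integral_Ioc, ← intervalIntegral.integral_of_le (by linarith), integral_inv_sqrt_one_add_mul_sq hc ρ, sq]

/-- The corner disc sits in the square: `{x² + y² < ρ²} ⊆ [−ρ,ρ]²` (`ρ ≥ 0`). [folklore] -/
theorem disc_subset_square {ρ : ℝ} (hρ : 0 ≤ ρ) : {p : ℝ × ℝ | p.1 ^ 2 + p.2 ^ 2 < ρ ^ 2} ⊆ Icc (-ρ) ρ ×ˢ Icc (-ρ) ρ := by
  intro p hp
  simp only [mem_setOf_eq] at hp
  have h1 : p.1 ^ 2 ≤ ρ ^ 2 := by nlinarith [sq_nonneg p.2]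
  have h2 : p.2 ^ 2 ≤ ρ ^ 2 := by nlinarith [sq_nonneg p.1]
  have h1' : |p.1| ≤ ρ := by have h := sq_le_sq.1 h1; rwa [abs_of_nonneg hρ] at h
  have h2' : |p.2| ≤ ρ := by have h := sq_le_sq.1 h2; rwa [abs_of_nonneg hρ] at h
  exact ⟨⟨(abs_le.1 h1').1, (abs_le.1 h1').2⟩, ⟨(abs_le.1 h2').1, (abs_le.1 h2').2⟩⟩

/-- ★ **THE DISC INTEGRAL**: `∫_{x²+y² < ρ²} (1 + c(x²+y²))⁻¹ ≤ (2·arsinh(√c·ρ)/√c)²` (`c > 0`, `ρ ≥ 0`). [folklore] -/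
theorem setIntegral_disc_inv_one_add_mul_le {c : ℝ} (hc : 0 < c) {ρ : ℝ} (hρ : 0 ≤ ρ) :
    ∫ p in {p : ℝ × ℝ | p.1 ^ 2 + p.2 ^ 2 < ρ ^ 2}, (1 + c * (p.1 ^ 2 + p.2 ^ 2))⁻¹ ≤ (2 * Real.arsinh (Real.sqrt c * ρ) / Real.sqrt c) ^ 2 := by
  refine le_trans (setIntegral_mono_set ?_ (Filter.Eventually.of_forall fun p => by positivity)
    (Filter.Eventually.of_forall (disc_subset_square hρ))) (setIntegral_square_inv_one_add_mul_le hc hρ)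
  -- integrable on the square: bounded by `1` on a set of finite measure
  have hfin : volume (Icc (-ρ) ρ ×ˢ Icc (-ρ) ρ) < ⊤ := by
    rw [Measure.volume_eq_prod, Measure.prod_prod]; exact ENNReal.mul_lt_top measure_Icc_lt_top measure_Icc_lt_top
  have hconst : IntegrableOn (fun _ : ℝ × ℝ => (1 : ℝ)) (Icc (-ρ) ρ ×ˢ Icc (-ρ) ρ) := (integrableOn_const_iff (by simp)).2 (Or.inr hfin)
  refine Integrable.mono' hconst (by fun_prop : Measurable fun p : ℝ × ℝ => (1 + c * (p.1 ^ 2 + p.2 ^ 2))⁻¹).aestronglyMeasurable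
    (Filter.Eventually.of_forall fun p => ?_)
  rw [Real.norm_eq_abs, abs_of_nonneg (by positivity)]
  exact inv_le_one_of_one_le₀ (by nlinarith [sq_nonneg p.1, sq_nonneg p.2, hc.le])

/-! ## §3 The tip letter: `arsinh² ≤ 64·(1+2z)^{1/4}` and `∫_{Ioi d} (1+δ²)^{−7/8} ≤ (8/3)·d^{−3/4}` -/

/-- `arsinh(z)² ≤ 64·(1 + 2z)^{1/4}` for `z ≥ 0` (`arsinh z ≤ log(1+2z) ≤ (1+2z)^{1/8}/(1/8)`). [folklore] -/
theorem arsinh_sq_le_rpow {z : ℝ} (hz : 0 ≤ z) : Real.arsinh z ^ 2 ≤ 64 * (1 + 2 * z) ^ (1 / 4 : ℝ) := by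
  have h0 : 0 ≤ Real.arsinh z := Real.arsinh_nonneg_iff.2 hz
  have h1 : Real.arsinh z ≤ Real.log (1 + 2 * z) := arsinh_le_log_one_add_two_mul hz
  have h2 : Real.log (1 + 2 * z) ≤ (1 + 2 * z) ^ (1 / 8 : ℝ) / (1 / 8) := Real.log_le_rpow_div (by linarith) (by norm_num)
  have h3 : Real.arsinh z ≤ 8 * (1 + 2 * z) ^ (1 / 8 : ℝ) := by linarith
  have h4 : 0 ≤ (1 + 2 * z) ^ (1 / 8 : ℝ) := Real.rpow_nonneg (by linarith) _
  have h5 : ((1 + 2 * z) ^ (1 / 8 : ℝ)) ^ 2 = (1 + 2 * z) ^ (1 / 4 : ℝ) := by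
    rw [← Real.rpow_natCast, ← Real.rpow_mul (by linarith)]; norm_num
  calc Real.arsinh z ^ 2 ≤ (8 * (1 + 2 * z) ^ (1 / 8 : ℝ)) ^ 2 := pow_le_pow_left₀ h0 h3 2
    _ = 64 * (1 + 2 * z) ^ (1 / 4 : ℝ) := by rw [mul_pow, h5]; norm_num

/-- ★ `∫_{Ioi d} (1+δ²)⁻¹·(1+δ²)^{1/8} dδ ≤ 2·(4/3)·d^{−3/4}` for `d ≥ 1` (`(1+δ²)^{−7/8} ≤ (δ²)^{−7/8} = δ^{−7/4}`, ✓`integral_Ioi_rpow_of_lt`). [folklore] -/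
theorem integral_Ioi_inv_one_add_sq_mul_rpow_le {d : ℝ} (hd : 1 ≤ d) :
    ∫ δ in Ioi d, (1 + δ ^ 2)⁻¹ * (1 + δ ^ 2) ^ (1 / 8 : ℝ) ≤ 2 * (4 / 3) * d ^ (-(3 / 4 : ℝ)) := by
  have hd0 : 0 < d := by linarith
  -- pointwise `≤ δ^{-7/4}` on `Ioi d`
  have hpt : ∀ δ ∈ Ioi d, (1 + δ ^ 2)⁻¹ * (1 + δ ^ 2) ^ (1 / 8 : ℝ) ≤ δ ^ (-(7 / 4) : ℝ) := by
    intro δ hδ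
    have hδ0 : 0 < δ := hd0.trans hδ
    have h1 : 0 < 1 + δ ^ 2 := by positivity
    have e1 : (1 + δ ^ 2)⁻¹ * (1 + δ ^ 2) ^ (1 / 8 : ℝ) = (1 + δ ^ 2) ^ (-(7 / 8) : ℝ) := by
      rw [← Real.rpow_neg_one, ← Real.rpow_add h1]; norm_num
    have e2 : δ ^ (-(7 / 4) : ℝ) = (δ ^ 2) ^ (-(7 / 8) : ℝ) := by
      rw [← Real.rpow_natCast δ 2, ← Real.rpow_mul hδ0.le]; norm_num
    rw [e1, e2]
    exact Real.rpow_le_rpow_of_nonpos (by positivity) (by nlinarith) (by norm_num)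
  have hInt : IntegrableOn (fun δ : ℝ => δ ^ (-(7 / 4) : ℝ)) (Ioi d) := integrableOn_Ioi_rpow_of_lt (by norm_num) hd0
  have hm : AEStronglyMeasurable (fun δ : ℝ => (1 + δ ^ 2)⁻¹ * (1 + δ ^ 2) ^ (1 / 8 : ℝ)) (volume.restrict (Ioi d)) := by
    exact (Measurable.mul (by fun_prop) ((Measurable.pow_const (by fun_prop) _))).aestronglyMeasurable
  have hInt' : IntegrableOn (fun δ : ℝ => (1 + δ ^ 2)⁻¹ * (1 + δ ^ 2) ^ (1 / 8 : ℝ)) (Ioi d) := by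
    refine Integrable.mono' hInt hm ?_
    filter_upwards [ae_restrict_mem measurableSet_Ioi] with δ hδ
    rw [Real.norm_eq_abs, abs_of_nonneg (by positivity)]
    exact hpt δ hδ
  have hmono := setIntegral_mono_on hInt' hInt measurableSet_Ioi hpt
  refine hmono.trans ?_
  rw [integral_Ioi_rpow_of_lt (by norm_num) hd0]
  have e : -d ^ (-(7 / 4 : ℝ) + 1) / (-(7 / 4 : ℝ) + 1) = (4 / 3) * d ^ (-(3 / 4 : ℝ)) := by
    rw [show (-(7 / 4 : ℝ) + 1) = -(3 / 4 : ℝ) by norm_num]; ring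
  rw [e]
  have h0 : 0 ≤ d ^ (-(3 / 4 : ℝ)) := Real.rpow_nonneg hd0.le _
  nlinarith

end Summit.QuantumFields.YangMills.Theorems.SwapVirialDeficit.SectorLaplace

end
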